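import Literature.MathematicalPhysics.QuantumManyBody.BoseGasBoundaryConditionIndependence
import HarnessLib

/-!
# The dilute thermodynamic limit `e₀(ρ) < ∞` and the eventual Dirichlet floor

Two small consequences of the tree's thermodynamic-limit theory for the Dirichlet / periodic
ground-state energy per particle of a repulsive finite-range Bose gas along the fixed-density box
sequence `L_N = (N/ρ)^{1/3}` (`BoseGasThermodynamicLimit.lean`, `BoseGasThermodynamicLimitRuelle.lean`,
`BoseGasBoundaryConditionIndependence.lean`), packaged for the variational ("Griffiths") arguments
of the BEC cruxes, which need the limit `e0 v ρ` to be FINITE and a genuine limit: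

* `exists_density_cap_tendsto_e0` — for every repulsive finite-range `v` there is an explicit
  density cap `ρ₂ = 1/(2(1+R)³) > 0` (`R` a range of `v`) such that for `0 < ρ < ρ₂` the tree's
  `e0 v ρ` (a `limUnder`) is finite and IS the limit of both the Dirichlet and the periodic energies
  per particle (LSSY 2005 Ch. 2, (2.2) and the paragraph after it; Ruelle 1969 §3.5.11 (a) for the
  existence below the critical density, finiteness by one particle per unit cell,
  `limsup_lt_top_of_small`);
* `eventually_floor_le_groundStateEnergy` — if `E₀^D(N, L_N)/N → e < ∞` then for every `ε > 0`,
  eventually `(e - ε) N ≤ E₀^D(N, L_N)` in `ℝ≥0∞` (the floor written `ofReal (e.toReal - ε) * N`,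
  `= 0` when `e ≤ ε`).

Design: no new definitions; `ℝ≥0∞` throughout, the real number `e.toReal - ε` entering only through
`ENNReal.ofReal`, so that no case distinction on `e ≤ ε` is needed downstream.
-/

noncomputable section

open _root_.MeasureTheory Filter Topology
open scoped ENNReal NNReal

namespace Literature.MathematicalPhysics.QuantumManyBody.BoseGas

variable {v : ℝ → ℝ≥0∞}

/-- **Dilute thermodynamic limit, finite and identified.** For every repulsive finite-range `v`
there is `ρ₂ > 0` (namely `1/(2(1+R)³)`, `R` a range of `v`) such that for `0 < ρ < ρ₂` the
thermodynamic-limit energy per particle `e0 v ρ` is finite and is the limit of the Dirichlet AND of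
the periodic energies per particle along `L_N = (N/ρ)^{1/3}`.
[cite: LSSY2005, Ch. 2 eq. (2.2) and the paragraph following it] -/
theorem exists_density_cap_tendsto_e0 (v : ℝ → ℝ≥0∞) (hv : IsRepulsiveFiniteRange v) :
    ∃ ρ₂ : ℝ, 0 < ρ₂ ∧ ∀ ρ : ℝ, 0 < ρ → ρ < ρ₂ →
      e0 v ρ ≠ ⊤ ∧ Tendsto (energyPerParticleDirichlet v ρ) atTop (𝓝 (e0 v ρ)) ∧
        Tendsto (energyPerParticlePeriodic v ρ) atTop (𝓝 (e0 v ρ)) := by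
  obtain ⟨R, hR, hv0⟩ := hv.exists_pos_range
  have hρ₀ : (0 : ℝ) < 1 / (2 * (1 + R) ^ 3) := by positivity
  have hsmall : 1 / (2 * (1 + R) ^ 3) * (1 + R) ^ 3 < 1 := by
    rw [div_mul_eq_mul_div, one_mul, div_lt_one (by positivity)]
    nlinarith [pow_pos (by linarith : 0 < 1 + R) 3]
  refine ⟨1 / (2 * (1 + R) ^ 3), hρ₀, fun ρ hρ hρlt => ?_⟩
  have hlt : ENNReal.ofReal ρ < criticalDensity v :=
    lt_of_lt_of_le ((ENNReal.ofReal_lt_ofReal_iff hρ₀).2 hρlt)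
      (ofReal_le_criticalDensity hv.1 hv0 hR hρ₀ hsmall)
  have hT := tendsto_energyPerParticleDirichlet_of_lt_criticalDensity hv hρ hlt
  have he0 : e0 v ρ = limsupEnergyPerParticle v ρ := hT.limUnder_eq
  have hfin : limsupEnergyPerParticle v ρ < ⊤ :=
    limsup_lt_top_of_small hv.1 hv0 hR hρ
      ((mul_lt_mul_of_pos_right hρlt (pow_pos (by linarith) 3)).trans hsmall)
  rw [he0]
  exact ⟨hfin.ne, hT, tendsto_energyPerParticlePeriodic_of_lt_criticalDensity hv hρ hlt⟩

/-- **Eventual Dirichlet floor.** If `E₀^D(N, L_N)/N → e < ∞` then for every `ε > 0`, eventually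
`(e - ε) N ≤ E₀^D(N, L_N)` (in `ℝ≥0∞`, the floor written as `ofReal (e.toReal - ε) * N`, which is
`0` when `e ≤ ε`). [folklore] -/
theorem eventually_floor_le_groundStateEnergy {ρ : ℝ} {e : ℝ≥0∞} (he : e ≠ ⊤)
    (hT : Tendsto (energyPerParticleDirichlet v ρ) atTop (𝓝 e)) {ε : ℝ} (hε : 0 < ε) :
    ∀ᶠ N : ℕ in atTop,
      ENNReal.ofReal (e.toReal - ε) * N ≤ groundStateEnergy v N (sideLength ρ N) := by
  by_cases hle : e.toReal ≤ ε
  · refine Eventually.of_forall fun N => ?_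
    rw [ENNReal.ofReal_of_nonpos (sub_nonpos.2 hle), zero_mul]
    exact bot_le
  · have hle : ε < e.toReal := lt_of_not_ge hle
    have hlt : ENNReal.ofReal (e.toReal - ε) < e := by
      conv_rhs => rw [← ENNReal.ofReal_toReal he]
      exact (ENNReal.ofReal_lt_ofReal_iff (hε.trans hle)).2 (sub_lt_self _ hε)
    filter_upwards [(tendsto_order.1 hT).1 _ hlt] with N hN
    exact ENNReal.mul_le_of_le_div hN.le

/-- The floor in the form used by sandwich arguments: if `E₀^D(N, L_N)/N → e < ∞` and `ε > 0`,
then eventually every finite energy value `E ≥ E₀^D(N, L_N)` satisfies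
`N (e.toReal - ε) ≤ E.toReal`. [folklore] -/
theorem eventually_mul_sub_le_toReal_of_groundStateEnergy_le {ρ : ℝ} {e : ℝ≥0∞} (he : e ≠ ⊤)
    (hT : Tendsto (energyPerParticleDirichlet v ρ) atTop (𝓝 e)) {ε : ℝ} (hε : 0 < ε) :
    ∀ᶠ N : ℕ in atTop, ∀ E : ℝ≥0∞, groundStateEnergy v N (sideLength ρ N) ≤ E → E ≠ ⊤ →
      (N : ℝ) * (e.toReal - ε) ≤ E.toReal := by
  filter_upwards [eventually_floor_le_groundStateEnergy he hT hε] with N hN E hE hEtop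
  have h := ENNReal.toReal_mono hEtop (hN.trans hE)
  rw [ENNReal.toReal_mul, ENNReal.toReal_natCast, ENNReal.toReal_ofReal'] at h
  calc (N : ℝ) * (e.toReal - ε) ≤ N * max (e.toReal - ε) 0 :=
        mul_le_mul_of_nonneg_left (le_max_left _ _) N.cast_nonneg
    _ = max (e.toReal - ε) 0 * N := mul_comm _ _
    _ ≤ E.toReal := h

end Literature.MathematicalPhysics.QuantumManyBody.BoseGas

end
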